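import Mathlib
import Summits.ValiantsHypothesis.ValiantsHypothesis.Theorems.BarrierLeverSuccinctHittingSetsForVPSeparableCoeffThree
import Summits.ValiantsHypothesis.ValiantsHypothesis.Theorems.BarrierLeverSuccinctHittingSetsForVPStubPrincipalMinors
import Summits.ValiantsHypothesis.ValiantsHypothesis.Theorems.BarrierLeverSuccinctHittingSetsForVPStubCatalecticantMaximal
import HarnessLib

/-!
# The catalecticant rows at exponent 3 (crux stmt-ValiantsHypothesis-14610 side; docket 8745/8749 of
seat val-np-p5): factorial polynomial, Sylvester's catalecticant determinants / maximal rank, and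
EVERY principal catalecticant minor — hit by ONE member of `SmallCircuits ℂ n 3`

**What is proved (unconditional; evidence for the open item 14610 in the direction the crux predicts
for rank methods; it does NOT close any item).** With `SeparableCoeffThree.separableCoeff_three`
(separable coefficient tensors at exponent `3`, the truncated-product dynamic programme) in place of
`stub_separableCoeff` (exponent `8`), the tree's catalecticant rows move from `SmallCircuits ℂ n 8`,
`n ≥ 8`, to `SmallCircuits ℂ n 3`, `n ≥ 6`, with verbatim the same Gram/Cholesky proofs:

* `exists_factorial_mem_smallCircuits_three` : the factorial polynomial `Σ_{|m|≤n} (∏_l m_l!) x^m`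
  (coefficients = product Laguerre moments) has degree `≤ n` and size `≤ n³`;
  `exists_allOnes_mem_smallCircuits_three` : so does `Σ_{|m| ≤ n} x^m`;
* `catalecticantDeterminant_three` (tree `stub_catalecticantDeterminant`): every square catalecticant
  block `[coeff_{u+w} f]_{|u|=|w|=k}`, `2k ≤ n`, is nonsingular at that ONE `f`;
* `catalecticantMaximal_three` (tree `stub_catalecticantMaximal`): every catalecticant
  `[coeff_{u+w} f]_{|u| = k, |w| ≤ n-k}` has full row rank at that `f`;
* `principalMinors_three` / `principalMinorsHit_three` (tree `stub_principalMinors(Hit)`): EVERY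
  principal catalecticant minor `det [coeff_{u_i+u_j} f]` (`u` injective, `2|u_i| ≤ n`; any size, any
  mixture of degrees) is nonzero at that `f`; hence `SmallCircuits ℂ n b`, `b ≥ 3`, succinctly hits
  all such minors and none of them is an algebraically natural proof against it
  (`principalMinorsHit_of_three_le`, `not_isNaturalProof_principalMinor`).

Why exponent 3 and not 2 (recorded for the planners; seat memo LANDSCAPE-8749-g17): the witness is a
Gram/positive-definite one (`coeff_{u+w} f = ⟨φ_u, φ_w⟩`), which forces product-moment coefficients,
i.e. a degree-`n` truncation of `∏_l G(x_l)`; the dynamic programme costs `n³ - n² + O(n)` gates and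
the elementary-symmetric / power-sum subroutines alone cost `≥ n²` naively, so `b = 2` (size `≤ n²`
on the nose) needs FFT-speed symmetric-function arithmetic (`O(n log² n)`), not formalised. A single
affine power `(1 + Σ x_l)^n` (size `n + 2 log n`) does NOT work: its raw middle catalecticant
`[C(n; u+w)]` has singular principal minors from `n = 5` on (numerics in the memo).

Honest framing: 14610-side bookkeeping; nothing here bears on the dense heart of 14610 or on
`VP ≠ VNP`.

References: Sylvester 1851/52 (catalecticants); [ForbesShpilkaVolk2018] §1.2 (rank methods are
algebraically natural), Construction 25, Question 6; [Burgisser2000] Rem. 2.7.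
-/

-- layout Summits/ValiantsHypothesis/ValiantsHypothesis forces the duplicated namespace component
set_option linter.dupNamespace false

noncomputable section

namespace Summit.ValiantsHypothesis.ValiantsHypothesis.Theorems.BarrierLever.SuccinctHittingSetsForVP

open Literature.Barriers.ValiantsHypothesis Literature.Computability.AlgebraicComplexity MvPolynomial

namespace CatalecticantThree

/-- **The factorial polynomial is a small circuit of exponent 3.** For `n ≥ 6` some
`f ∈ SmallCircuits ℂ n 3` has `coeff_m f = ∏_i m_i!` for every `m` of degree `≤ n`
(tree: `CatalecticantMaximal.exists_factorial_mem_smallCircuits`, exponent `8`).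
[cite: ForbesShpilkaVolk2018, Construction 25] -/
theorem exists_factorial_mem_smallCircuits_three (n : ℕ) (hn : 6 ≤ n) :
    ∃ f ∈ SmallCircuits ℂ n 3, ∀ m : Fin n →₀ ℕ, m.degree ≤ n →
      coeff m f = ∏ i, ((m i).factorial : ℂ) := by
  obtain ⟨Λ, hΛ, hcoeff⟩ :=
    SeparableCoeffThree.separableCoeff_three n hn (fun _ j => (j.factorial : ℂ))
  exact ⟨Λ, hΛ, fun m hm => hcoeff ⟨m, hm⟩⟩

/-- **The all-ones polynomial `Σ_{|m| ≤ n} x^m` is a small circuit of exponent 3** (tree: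
`exists_allOnes_mem_smallCircuits`, exponent `8`). [cite: ForbesShpilkaVolk2018, Construction 25] -/
theorem exists_allOnes_mem_smallCircuits_three (n : ℕ) (hn : 6 ≤ n) :
    ∃ f ∈ SmallCircuits ℂ n 3, ∀ m : Fin n →₀ ℕ, m.degree ≤ n → coeff m f = 1 := by
  obtain ⟨Λ, hΛ, hcoeff⟩ := SeparableCoeffThree.separableCoeff_three n hn (fun _ _ => 1)
  refine ⟨Λ, hΛ, fun m hm => ?_⟩
  have h := hcoeff ⟨m, hm⟩
  rw [Finset.prod_const_one] at h
  exact h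

end CatalecticantThree

open CatalecticantThree

/-- **Sylvester's catalecticant determinants are hit at exponent 3**: for `n ≥ 6` ONE
`f ∈ SmallCircuits ℂ n 3` (the factorial polynomial) has `det [coeff_{u+w} f]_{|u|=|w|=k} ≠ 0` for
every `k ≤ n/2` (tree: `stub_catalecticantDeterminant`, exponent `8`; same Gram/Cholesky proof
`CatalecticantDeterminant.det_of_prod_factorial_ne_zero`). [folklore] -/
theorem catalecticantDeterminant_three :
    ∀ n : ℕ, 6 ≤ n → ∃ f ∈ SmallCircuits ℂ n 3, ∀ (k : ℕ) [Fintype {u : Fin n →₀ ℕ // u.degree = k}],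
      2 * k ≤ n →
        (Matrix.of fun u w : {u : Fin n →₀ ℕ // u.degree = k} =>
          MvPolynomial.coeff (u.1 + w.1) f).det ≠ 0 := by
  -- adapted from the tree's `stub_catalecticantDeterminant` (exponent 8)
  intro n hn
  obtain ⟨f, hf, hcoef⟩ := exists_factorial_mem_smallCircuits_three n hn
  refine ⟨f, hf, ?_⟩
  intro k _ hk
  have hM : (Matrix.of fun u w : {u : Fin n →₀ ℕ // u.degree = k} =>
        MvPolynomial.coeff (u.1 + w.1) f) =
      (Matrix.of fun u w : {u : Fin n →₀ ℕ // u.degree = k} =>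
        ∏ i, (((u.1 + w.1) i).factorial : ℚ)).map (fun x : ℚ => (x : ℂ)) := by
    ext u w
    have hdeg : (u.1 + w.1).degree ≤ n := by
      rw [map_add, u.2, w.2]
      omega
    simp only [Matrix.map_apply, Matrix.of_apply, Rat.cast_prod, Rat.cast_natCast]
    exact hcoef _ hdeg
  rw [hM, ← Rat.cast_det, Rat.cast_ne_zero]
  exact CatalecticantDeterminant.det_of_prod_factorial_ne_zero


open CatalecticantMaximal PartialsIndependent in
/-- **Sylvester's catalecticant rank is maximal at exponent 3**: for `n ≥ 6` ONE
`f ∈ SmallCircuits ℂ n 3` (the factorial polynomial) has, for every `k ≤ n/2`, linearly independent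
catalecticant rows `u ↦ (w ↦ coeff_{u+w} f)` (`|u| = k`, `|w| ≤ n - k`) (tree:
`stub_catalecticantMaximal`, exponent `8`; verbatim its proof with the exponent-3 witnesses).
[folklore] -/
theorem catalecticantMaximal_three :
    ∀ n : ℕ, 6 ≤ n → ∃ f ∈ SmallCircuits ℂ n 3, ∀ k : ℕ, 2 * k ≤ n →
      LinearIndependent ℂ
        (fun u : {u : Fin n →₀ ℕ // u.degree = k} =>
          fun w : {w : Fin n →₀ ℕ // w.degree ≤ n - k} => MvPolynomial.coeff (u.1 + w.1) f) := by
  -- adapted from the tree's `stub_catalecticantMaximal` (exponent 8)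
  intro n hn
  obtain ⟨f, hf, hcoefF⟩ := exists_factorial_mem_smallCircuits_three n hn
  obtain ⟨g, hg, hcoefG⟩ := exists_allOnes_mem_smallCircuits_three n hn
  refine ⟨f, hf, fun k hk => ?_⟩
  have hLI := stub_partialsIndependent stub_risingDiagonal n k g hk hcoefG
  rw [linearIndependent_iff'] at hLI ⊢
  intro s a hsum
  refine hLI s a (MvPolynomial.ext _ _ fun w => ?_)
  rw [coeff_sum, coeff_zero]
  simp_rw [coeff_smul, smul_eq_mul]
  by_cases hw : w.degree ≤ n - k
  · have key := congrFun hsum ⟨w, hw⟩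
    rw [Finset.sum_apply, Pi.zero_apply] at key
    simp_rw [Pi.smul_apply, smul_eq_mul] at key
    have hdeg : ∀ u : {u : Fin n →₀ ℕ // u.degree = k}, (w + u.1).degree ≤ n := by
      intro u
      rw [map_add]
      have hu := u.2
      omega
    have key' : (∏ i, ((w i).factorial : ℂ)) *
        ∑ u ∈ s, a u * coeff w (apolarAction (monomial u.1 (1 : ℂ)) g) = 0 := by
      rw [← key, Finset.mul_sum]
      refine Finset.sum_congr rfl fun u _ => ?_
      have hdeg' : (u.1 + w).degree ≤ n := by rw [add_comm]; exact hdeg u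
      rw [coeff_apolarAction_monomial_one_eq_prod hcoefG u.1 w (hdeg u), hcoefF _ hdeg',
        prod_factorial_add_eq]
      ring
    exact (mul_eq_zero.mp key').resolve_left (prod_factorial_ne_zero w)
  · refine Finset.sum_eq_zero fun u _ => ?_
    rw [coeff_apolarAction_monomial_eq_zero u.1 w, mul_zero]
    rw [map_add]
    have hu := u.2
    have hgdeg : g.totalDegree ≤ n := hg.1
    omega

/-- **EVERY principal catalecticant minor is hit at exponent 3**: for `n ≥ 6` ONE
`f ∈ SmallCircuits ℂ n 3` (the factorial polynomial) has `det [coeff_{u_i + u_j} f]_{i,j} ≠ 0` for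
every finite injective family `u` with `2|u_i| ≤ n` — any size, any selection of rows of mixed
degrees (tree: `stub_principalMinors`, exponent `8`; same positive-definite Gram proof
`PrincipalMinors.det_of_prod_factorial_ne_zero`). [cite: ForbesShpilkaVolk2018, §1.2] -/
theorem principalMinors_three :
    ∀ n : ℕ, 6 ≤ n → ∃ f ∈ SmallCircuits ℂ n 3,
      ∀ (ι : Type) [Fintype ι] [DecidableEq ι] (u : ι → (Fin n →₀ ℕ)), Function.Injective u →
        (∀ i, 2 * (u i).degree ≤ n) →
        (Matrix.of fun i j : ι => MvPolynomial.coeff (u i + u j) f).det ≠ 0 := by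
  -- adapted from the tree's `stub_principalMinors` (exponent 8)
  intro n hn
  obtain ⟨f, hf, hcoef⟩ := exists_factorial_mem_smallCircuits_three n hn
  refine ⟨f, hf, ?_⟩
  intro ι _ _ u hinj hdeg
  have hM : (Matrix.of fun i j : ι => MvPolynomial.coeff (u i + u j) f) =
      (Matrix.of fun i j : ι => ∏ l, (((u i + u j) l).factorial : ℚ)).map
        (fun x : ℚ => (x : ℂ)) := by
    ext i j
    have hd : (u i + u j).degree ≤ n := by
      rw [map_add]
      have hi := hdeg i
      have hj := hdeg j
      omega
    simp only [Matrix.map_apply, Matrix.of_apply, Rat.cast_prod, Rat.cast_natCast]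
    exact hcoef _ hd
  rw [hM, ← Rat.cast_det, Rat.cast_ne_zero]
  exact PrincipalMinors.det_of_prod_factorial_ne_zero u hinj

/-- **Hitting-set form**: for `n ≥ 6`, `SmallCircuits ℂ n 3` is a succinct hitting set for every
polynomial in the coefficient variables whose value at every coefficient vector is a principal
catalecticant minor `det [coeff_{u_i + u_j} f]` (`u` injective, `2|u_i| ≤ n`) — one witness for all
of them (tree: `stub_principalMinorsHit`, exponent `8`). [cite: ForbesShpilkaVolk2018, §1.2] -/
theorem principalMinorsHit_three :
    ∀ n : ℕ, 6 ≤ n →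
      IsSuccinctHittingSet (degLEMonomials n) (SmallCircuits ℂ n 3)
        {D | ∃ (ι : Type) (_ : Fintype ι) (_ : DecidableEq ι) (u : ι → (Fin n →₀ ℕ)),
          Function.Injective u ∧ (∀ i, 2 * (u i).degree ≤ n) ∧
          ∀ f : MvPolynomial (Fin n) ℂ, MvPolynomial.eval (coeffVector (degLEMonomials n) f) D =
            (Matrix.of fun i j : ι => MvPolynomial.coeff (u i + u j) f).det} := by
  intro n hn
  obtain ⟨f, hf, hdet⟩ := principalMinors_three n hn
  intro D hD _
  obtain ⟨ι, _, _, u, hinj, hdeg, hD⟩ := hD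
  refine ⟨f, hf, ?_⟩
  rw [hD f]
  exact hdet ι u hinj hdeg

/-- … hence the same holds inside `SmallCircuits ℂ n b` for every `b ≥ 3` (`n ≥ 6`). [folklore] -/
theorem principalMinorsHit_of_three_le {n b : ℕ} (hn : 6 ≤ n) (hb : 3 ≤ b) :
    IsSuccinctHittingSet (degLEMonomials n) (SmallCircuits ℂ n b)
      {D | ∃ (ι : Type) (_ : Fintype ι) (_ : DecidableEq ι) (u : ι → (Fin n →₀ ℕ)),
        Function.Injective u ∧ (∀ i, 2 * (u i).degree ≤ n) ∧
        ∀ f : MvPolynomial (Fin n) ℂ, MvPolynomial.eval (coeffVector (degLEMonomials n) f) D =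
          (Matrix.of fun i j : ι => MvPolynomial.coeff (u i + u j) f).det} :=
  (principalMinorsHit_three n hn).mono (smallCircuits_mono ℂ hb (by omega)) le_rfl

/-- **No principal-catalecticant-minor natural proof against `SmallCircuits ℂ n b`, `b ≥ 3`**
(`n ≥ 6`): a distinguisher whose value is such a minor vanishes somewhere it should not.
[cite: ForbesShpilkaVolk2018, Thm. 4] -/
theorem not_isNaturalProof_principalMinor {n b : ℕ} (hn : 6 ≤ n) (hb : 3 ≤ b)
    (𝒟 : Set (MvPolynomial (degLEMonomials n) ℂ)) {D : MvPolynomial (degLEMonomials n) ℂ}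
    (hD : ∃ (ι : Type) (_ : Fintype ι) (_ : DecidableEq ι) (u : ι → (Fin n →₀ ℕ)),
      Function.Injective u ∧ (∀ i, 2 * (u i).degree ≤ n) ∧
      ∀ f : MvPolynomial (Fin n) ℂ, MvPolynomial.eval (coeffVector (degLEMonomials n) f) D =
        (Matrix.of fun i j : ι => MvPolynomial.coeff (u i + u j) f).det) :
    ¬ IsNaturalProof (degLEMonomials n) (SmallCircuits ℂ n b) 𝒟 D := by
  rintro ⟨-, hD0, hvan⟩
  obtain ⟨f, hf, hne⟩ := principalMinorsHit_of_three_le hn hb D hD hD0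
  exact hne (hvan f hf)

end Summit.ValiantsHypothesis.ValiantsHypothesis.Theorems.BarrierLever.SuccinctHittingSetsForVP

end
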